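import Literature.AlgebraicGeometry.Frobenioids.CategoriesFactorizationRevised
import Mathlib.CategoryTheory.Category.Preorder
import Mathlib.Data.Sum.Order
import Mathlib.Data.Sigma.Order
import Mathlib.Order.Fin.Basic
import HarnessLib

/-!
# Frobenioids I, §0: a category of FSMFF-type in the printed (2008) sense which is NOT of FSMFF-type in
# the author's revised (2024) sense — the "broom"

Mochizuki, *The geometry of Frobenioids I: the general theory*, Kyushu J. Math. **62** (2008) 293–400, §0
"Categories", kurims text pp. 14, 17–18 [cite: MochizukiFrdI2008, §0 p.17], and the author's *Comments*
(January 2024), item (28), revising condition (b) of "FSMFF-type" [cite: MochizukiFrdIComments2024, (28) p.3].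

PROOF-ONLY file (no definitions; seat abc-iut-w4-d093). `CategoriesFactorizationRevised.lean` records in
prose that the revised condition (b) is "a strictly stronger requirement" than the printed one
(`IsOfFSMFFType2024.isOfFSMFFType` is the implication). This file supplies the kernel witness of STRICTNESS:
the preorder category on `(Unit ⊕ Unit) ⊕ₗ (Σ k : ℕ, Fin (k + 1))` — two INCOMPARABLE bottom points below a
disjoint family of finite chains ("teeth") `(k, 0) < (k, 1) < ⋯ < (k, k)`, one of each length — is of
FSMFF-type as printed in 2008 but not in the 2024 sense:
* its FSM-morphisms are the identities and the arrows inside a tooth (an arrow out of a bottom point is not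
  fiberwise-surjective: the OTHER bottom point lies under its codomain and has no common lower bound with it);
  its FSMI-morphisms are the covering arrows `(k, i) → (k, i + 1)`;
* (a) holds (an arrow `(k, i) → (k, j)`, `i < j`, is the composite of `j - i` covers) and (b)-2008 holds
  (chains of FSMI-morphisms out of `(k, i)` have length `≤ k`; none leaves a bottom point);
* (b)-2024 FAILS at a bottom point: the composite "bottom → `(k, 0)` → `(k, 1)` → ⋯ → `(k, k)`" has an
  arbitrary head followed by `k` FSMI-morphisms, for every `k`.
Hence `Broom.exists_isOfFSMFFType_not_isOfFSMFFType2024`. Together with `FSMFFType2024WalkingArrow.lean`: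
FSM-type ⊊ FSMFF-type (2024) ⊊ FSMFF-type (2008), all three strict in the kernel. Consequence for the
cell's bookkeeping: results proved over bases of FSMFF-type (2024) (e.g. [FrdI] Thm. 3.4 (ii)–(v) as typed,
`FrdI.thm34iii_ofFunctor_of_isOfFSMFFType2024`) do NOT cover all bases admitted by the printed 2008
hypothesis. Nothing here is a claim of the paper beyond §0's definitions; nothing bears on [IUTchIII].
-/

namespace Literature.AlgebraicGeometry.Frobenioids

namespace Broom

open CategoryTheory

/-! ### Order facts on `(Unit ⊕ Unit) ⊕ₗ (Σ k, Fin (k+1))` -/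

/-- Two teeth points are comparable iff they lie on the same tooth, in order. [folklore] -/
private theorem tooth_le_iff (s t : Σ k : ℕ, Fin (k + 1)) :
    (toLex (Sum.inr s) : Lex ((Unit ⊕ Unit) ⊕ (Σ k : ℕ, Fin (k + 1)))) ≤ toLex (Sum.inr t) ↔
      s.1 = t.1 ∧ (s.2 : ℕ) ≤ (t.2 : ℕ) := by
  rw [Sum.Lex.inr_le_inr_iff]
  obtain ⟨k, i⟩ := s
  obtain ⟨k', j⟩ := t
  constructor
  · intro h
    obtain ⟨hk, hij⟩ := Sigma.le_def.mp h
    dsimp only at hk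
    subst hk
    exact ⟨rfl, hij⟩
  · rintro ⟨hk, hij⟩
    dsimp only at hk
    subst hk
    exact Sigma.mk_le_mk_iff.mpr hij

/-- Same tooth, explicit indices. [folklore] -/
private theorem tooth_mk_le_iff (k : ℕ) (i j : Fin (k + 1)) :
    (toLex (Sum.inr ⟨k, i⟩) : Lex ((Unit ⊕ Unit) ⊕ (Σ k : ℕ, Fin (k + 1)))) ≤ toLex (Sum.inr ⟨k, j⟩) ↔
      (i : ℕ) ≤ (j : ℕ) := by
  rw [tooth_le_iff]
  exact ⟨fun h => h.2, fun h => ⟨rfl, h⟩⟩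

/-- Two points of the same tooth coincide iff their heights do. [folklore] -/
private theorem tooth_eq_iff (k : ℕ) (i j : Fin (k + 1)) :
    (toLex (Sum.inr ⟨k, i⟩) : Lex ((Unit ⊕ Unit) ⊕ (Σ k : ℕ, Fin (k + 1)))) = toLex (Sum.inr ⟨k, j⟩) ↔
      (i : ℕ) = (j : ℕ) := by
  constructor
  · intro h
    have h' := le_antisymm_iff.mp h
    exact le_antisymm ((tooth_mk_le_iff k i j).mp h'.1) ((tooth_mk_le_iff k j i).mp h'.2)
  · intro h
    rw [Fin.ext h]

/-- A bottom point lies under every tooth point. [folklore] -/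
private theorem bot_le_tooth (b : Unit ⊕ Unit) (t : Σ k : ℕ, Fin (k + 1)) :
    (toLex (Sum.inl b) : Lex ((Unit ⊕ Unit) ⊕ (Σ k : ℕ, Fin (k + 1)))) ≤ toLex (Sum.inr t) :=
  Sum.Lex.inl_le_inr _ _

/-- No tooth point lies under a bottom point. [folklore] -/
private theorem not_tooth_le_bot (b : Unit ⊕ Unit) (t : Σ k : ℕ, Fin (k + 1)) :
    ¬ (toLex (Sum.inr t) : Lex ((Unit ⊕ Unit) ⊕ (Σ k : ℕ, Fin (k + 1)))) ≤ toLex (Sum.inl b) :=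
  Sum.Lex.not_inr_le_inl

/-- The two bottom points are comparable only when equal. [folklore] -/
private theorem bot_le_bot_iff (b b' : Unit ⊕ Unit) :
    (toLex (Sum.inl b) : Lex ((Unit ⊕ Unit) ⊕ (Σ k : ℕ, Fin (k + 1)))) ≤ toLex (Sum.inl b') ↔ b = b' := by
  rw [Sum.Lex.inl_le_inl_iff]
  rcases b with ⟨⟨⟩⟩ | ⟨⟨⟩⟩ <;> rcases b' with ⟨⟨⟩⟩ | ⟨⟨⟩⟩
  · exact ⟨fun _ => rfl, fun _ => Sum.inl_le_inl_iff.mpr le_rfl⟩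
  · exact ⟨fun h => (Sum.not_inl_le_inr h).elim, fun h => by cases h⟩
  · exact ⟨fun h => (Sum.not_inr_le_inl h).elim, fun h => by cases h⟩
  · exact ⟨fun _ => rfl, fun _ => Sum.inr_le_inr_iff.mpr le_rfl⟩

/-- The other bottom point. [folklore] -/
private theorem exists_ne_bot (b : Unit ⊕ Unit) : ∃ b' : Unit ⊕ Unit, b' ≠ b := by
  rcases b with ⟨⟨⟩⟩ | ⟨⟨⟩⟩
  · exact ⟨Sum.inr (), Sum.inr_ne_inl⟩
  · exact ⟨Sum.inl (), Sum.inl_ne_inr⟩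

/-! ### Arrows of the preorder category -/

/-- In the (partial-order) category an arrow is an isomorphism iff its ends coincide.
[cite: MochizukiFrdI2008, §0 p.14] -/
theorem isIso_iff_eq {x y : Lex ((Unit ⊕ Unit) ⊕ (Σ k : ℕ, Fin (k + 1)))} (f : x ⟶ y) :
    IsIso f ↔ x = y := by
  constructor
  · intro h
    exact le_antisymm (leOfHom f) (leOfHom (inv f))
  · rintro rfl
    rw [show f = 𝟙 x from Subsingleton.elim _ _]
    infer_instance

/-- Fiberwise-surjectivity in a thin category: every point under the codomain has a common lower bound with
the domain. [cite: MochizukiFrdI2008, §0 p.14] -/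
theorem isFiberwiseSurjective_iff {x y : Lex ((Unit ⊕ Unit) ⊕ (Σ k : ℕ, Fin (k + 1)))} (f : x ⟶ y) :
    IsFiberwiseSurjective f ↔ ∀ w, w ≤ y → ∃ d, d ≤ x ∧ d ≤ w := by
  constructor
  · intro h w hw
    obtain ⟨d, δB, δX, -⟩ := h (homOfLE hw)
    exact ⟨d, leOfHom δB, leOfHom δX⟩
  · intro h X γ
    obtain ⟨d, hdx, hdX⟩ := h X (leOfHom γ)
    exact ⟨d, homOfLE hdx, homOfLE hdX, Subsingleton.elim _ _⟩

/-- An FSM-morphism out of a bottom point is an isomorphism: under a tooth point lies the OTHER bottom point,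
which has no common lower bound with the given one. [cite: MochizukiFrdI2008, §0 p.14] -/
theorem isIso_of_isFSM_bot (b : Unit ⊕ Unit) {y : Lex ((Unit ⊕ Unit) ⊕ (Σ k : ℕ, Fin (k + 1)))}
    (f : (toLex (Sum.inl b) : Lex ((Unit ⊕ Unit) ⊕ (Σ k : ℕ, Fin (k + 1)))) ⟶ y) (hf : IsFSM f) :
    IsIso f := by
  rw [isIso_iff_eq]
  induction y using Lex.rec with
  | h y => ?_
  rcases y with b' | t
  · exact congrArg _ (congrArg _ ((bot_le_bot_iff b b').mp (leOfHom f)))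
  · exfalso
    obtain ⟨b', hb'⟩ := exists_ne_bot b
    obtain ⟨d, hdb, hdb'⟩ := (isFiberwiseSurjective_iff f).mp hf.1 (toLex (Sum.inl b')) (bot_le_tooth b' t)
    induction d using Lex.rec with
    | h d => ?_
    rcases d with c | s
    · exact hb' (((bot_le_bot_iff c b').mp hdb').symm.trans ((bot_le_bot_iff c b).mp hdb))
    · exact not_tooth_le_bot b s hdb

/-- An arrow out of a tooth point ends on the same tooth, further up. [cite: MochizukiFrdI2008, §0 p.17] -/
theorem eq_of_hom_tooth (s : Σ k : ℕ, Fin (k + 1)) {y : Lex ((Unit ⊕ Unit) ⊕ (Σ k : ℕ, Fin (k + 1)))}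
    (f : (toLex (Sum.inr s) : Lex ((Unit ⊕ Unit) ⊕ (Σ k : ℕ, Fin (k + 1)))) ⟶ y) :
    ∃ t : Σ k : ℕ, Fin (k + 1), y = toLex (Sum.inr t) ∧ s.1 = t.1 ∧ (s.2 : ℕ) ≤ (t.2 : ℕ) := by
  induction y using Lex.rec with
  | h y => ?_
  rcases y with b | t
  · exact (not_tooth_le_bot b s (leOfHom f)).elim
  · exact ⟨t, rfl, (tooth_le_iff s t).mp (leOfHom f)⟩

/-- Every arrow out of a tooth point is an FSM-morphism. [cite: MochizukiFrdI2008, §0 p.14] -/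
theorem isFSM_of_tooth (s : Σ k : ℕ, Fin (k + 1)) {y : Lex ((Unit ⊕ Unit) ⊕ (Σ k : ℕ, Fin (k + 1)))}
    (f : (toLex (Sum.inr s) : Lex ((Unit ⊕ Unit) ⊕ (Σ k : ℕ, Fin (k + 1)))) ⟶ y) : IsFSM f := by
  refine ⟨(isFiberwiseSurjective_iff f).mpr fun w hw => ?_, ⟨fun _ _ _ => Subsingleton.elim _ _⟩⟩
  obtain ⟨t, rfl, hst, -⟩ := eq_of_hom_tooth s f
  induction w using Lex.rec with
  | h w => ?_
  rcases w with c | r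
  · exact ⟨toLex (Sum.inl c), bot_le_tooth c s, le_rfl⟩
  · exact ⟨toLex (Sum.inl (Sum.inl ())), bot_le_tooth _ s, bot_le_tooth _ r⟩

/-- An FSMI-morphism out of a tooth point `(k, i)` ends at `(k, i + 1)`. [cite: MochizukiFrdI2008, §0 p.17] -/
theorem eq_succ_of_isFSMI_tooth (s : Σ k : ℕ, Fin (k + 1)) {y : Lex ((Unit ⊕ Unit) ⊕ (Σ k : ℕ, Fin (k + 1)))}
    (f : (toLex (Sum.inr s) : Lex ((Unit ⊕ Unit) ⊕ (Σ k : ℕ, Fin (k + 1)))) ⟶ y) (hf : IsFSMI f) :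
    ∃ t : Σ k : ℕ, Fin (k + 1), y = toLex (Sum.inr t) ∧ s.1 = t.1 ∧ (t.2 : ℕ) = (s.2 : ℕ) + 1 := by
  obtain ⟨t, rfl, hst, hle⟩ := eq_of_hom_tooth s f
  refine ⟨t, rfl, hst, ?_⟩
  obtain ⟨k, i⟩ := s
  obtain ⟨k', j⟩ := t
  dsimp only at hst
  subst hst
  change (i : ℕ) ≤ (j : ℕ) at hle
  change (j : ℕ) = (i : ℕ) + 1
  -- not an isomorphism: `i < j`
  have hne : (i : ℕ) ≠ j := fun h => hf.2.1 ((isIso_iff_eq f).mpr ((tooth_eq_iff k i j).mpr h))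
  rcases Nat.lt_or_ge (i + 1 : ℕ) j with hlt | hge
  · -- `j ≥ i + 2`: factor through `(k, i+1)`, neither factor an isomorphism
    exfalso
    have hi1 : (i : ℕ) + 1 < k + 1 := by have := j.isLt; omega
    have hm : ((⟨(i : ℕ) + 1, hi1⟩ : Fin (k + 1)) : ℕ) = i + 1 := rfl
    have h₁ : (toLex (Sum.inr ⟨k, i⟩) : Lex ((Unit ⊕ Unit) ⊕ (Σ k : ℕ, Fin (k + 1)))) ≤
        toLex (Sum.inr ⟨k, ⟨(i : ℕ) + 1, hi1⟩⟩) := (tooth_mk_le_iff k _ _).mpr (by omega)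
    have h₂ : (toLex (Sum.inr ⟨k, ⟨(i : ℕ) + 1, hi1⟩⟩) : Lex ((Unit ⊕ Unit) ⊕ (Σ k : ℕ, Fin (k + 1)))) ≤
        toLex (Sum.inr ⟨k, j⟩) := (tooth_mk_le_iff k _ _).mpr (by omega)
    rcases hf.2.2 (homOfLE h₁) (homOfLE h₂) (Subsingleton.elim _ _) with hα | hβ
    · have := (tooth_eq_iff k _ _).mp ((isIso_iff_eq _).mp hα)
      omega
    · have := (tooth_eq_iff k _ _).mp ((isIso_iff_eq _).mp hβ)
      omega
  · omega

/-- A chain of `n` FSMI-morphisms out of the tooth point `(k, i)` ends at `(k, i + n)`; in particular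
`n ≤ k`. [cite: MochizukiFrdI2008, §0 p.17] -/
theorem isFSMIChain_tooth {x y : Lex ((Unit ⊕ Unit) ⊕ (Σ k : ℕ, Fin (k + 1)))} (f : x ⟶ y) (n : ℕ)
    (h : IsFSMIChain f n) :
    ∀ s : Σ k : ℕ, Fin (k + 1), x = toLex (Sum.inr s) →
      ∃ t : Σ k : ℕ, Fin (k + 1), y = toLex (Sum.inr t) ∧ s.1 = t.1 ∧ (t.2 : ℕ) = (s.2 : ℕ) + n := by
  induction h with
  | single φ hφ =>
    rintro s rfl
    exact eq_succ_of_isFSMI_tooth s φ hφ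
  | cons ψ χ m hψ _ ih =>
    rintro s rfl
    obtain ⟨r, hr, hsr, hr2⟩ := eq_succ_of_isFSMI_tooth s ψ hψ
    subst hr
    obtain ⟨t, rfl, hrt, ht2⟩ := ih r rfl
    exact ⟨t, rfl, hsr.trans hrt, by omega⟩

/-- No chain of FSMI-morphisms leaves a bottom point. [cite: MochizukiFrdI2008, §0 p.17] -/
theorem not_isFSMIChain_bot (b : Unit ⊕ Unit) {y : Lex ((Unit ⊕ Unit) ⊕ (Σ k : ℕ, Fin (k + 1)))}
    (f : (toLex (Sum.inl b) : Lex ((Unit ⊕ Unit) ⊕ (Σ k : ℕ, Fin (k + 1)))) ⟶ y) (n : ℕ)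
    (h : IsFSMIChain f n) : False := by
  obtain ⟨X, ψ, hψ⟩ := h.exists_isFSMI
  exact hψ.2.1 (isIso_of_isFSM_bot b ψ hψ.1)

/-- The covering arrow `(k, i) → (k, i+1)` of a tooth is an FSMI-morphism. [cite: MochizukiFrdI2008, §0 p.17] -/
theorem isFSMI_cover (k : ℕ) (i j : Fin (k + 1)) (hij : (j : ℕ) = i + 1) :
    IsFSMI (homOfLE ((tooth_mk_le_iff k i j).mpr (by omega)) :
      (toLex (Sum.inr ⟨k, i⟩) : Lex ((Unit ⊕ Unit) ⊕ (Σ k : ℕ, Fin (k + 1)))) ⟶ toLex (Sum.inr ⟨k, j⟩)) := by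
  refine ⟨isFSM_of_tooth _ _, fun h => ?_, fun X β α _ => ?_⟩
  · have := (tooth_eq_iff k i j).mp ((isIso_iff_eq _).mp h)
    omega
  · obtain ⟨t, rfl, hst, hle⟩ := eq_of_hom_tooth ⟨k, i⟩ β
    obtain ⟨k', l⟩ := t
    dsimp only at hst
    subst hst
    change (i : ℕ) ≤ (l : ℕ) at hle
    have hle' : (l : ℕ) ≤ (j : ℕ) := (tooth_mk_le_iff k l j).mp (leOfHom α)
    rcases Nat.lt_or_ge (l : ℕ) j with h1 | h1
    · right
      exact (isIso_iff_eq _).mpr ((tooth_eq_iff k i l).mpr (by omega))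
    · left
      exact (isIso_iff_eq _).mpr ((tooth_eq_iff k l j).mpr (by omega))

/-- Inside a tooth, the arrow `(k, i) → (k, i + d + 1)` is a composite of `d + 1` covering arrows.
[cite: MochizukiFrdI2008, §0 p.17] -/
theorem isFSMIChain_of_tooth (k : ℕ) : ∀ (d : ℕ) (i j : Fin (k + 1)) (hij : (j : ℕ) = i + d + 1),
    IsFSMIChain (homOfLE ((tooth_mk_le_iff k i j).mpr (by omega)) :
      (toLex (Sum.inr ⟨k, i⟩) : Lex ((Unit ⊕ Unit) ⊕ (Σ k : ℕ, Fin (k + 1)))) ⟶ toLex (Sum.inr ⟨k, j⟩))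
      (d + 1) := by
  intro d
  induction d with
  | zero =>
    intro i j hij
    exact IsFSMIChain.single _ (isFSMI_cover k i j (by omega))
  | succ d ih =>
    intro i j hij
    have hi1 : (i : ℕ) + 1 < k + 1 := by have := j.isLt; omega
    have hm : ((⟨(i : ℕ) + 1, hi1⟩ : Fin (k + 1)) : ℕ) = i + 1 := rfl
    have hcov := isFSMI_cover k i ⟨(i : ℕ) + 1, hi1⟩ hm
    have htail := ih ⟨(i : ℕ) + 1, hi1⟩ j (by omega)
    have := IsFSMIChain.cons _ _ (d + 1) hcov htail
    rwa [show (homOfLE ((tooth_mk_le_iff k i ⟨(i : ℕ) + 1, hi1⟩).mpr (by omega)) ≫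
        homOfLE ((tooth_mk_le_iff k ⟨(i : ℕ) + 1, hi1⟩ j).mpr (by omega)) :
        (toLex (Sum.inr ⟨k, i⟩) : Lex ((Unit ⊕ Unit) ⊕ (Σ k : ℕ, Fin (k + 1)))) ⟶ toLex (Sum.inr ⟨k, j⟩)) =
        homOfLE ((tooth_mk_le_iff k i j).mpr (by omega)) from Subsingleton.elim _ _] at this

/-! ### The two verdicts -/

/-- **The broom is of FSMFF-type in the printed (2008) sense.** (a): a non-invertible FSM-morphism lives
inside a tooth and is a composite of covering arrows; (b): chains of FSMI-morphisms out of `(k, i)` have length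
at most `k`, and none leaves a bottom point. [cite: MochizukiFrdI2008, §0 p.17] -/
theorem isOfFSMFFType : IsOfFSMFFType (Lex ((Unit ⊕ Unit) ⊕ (Σ k : ℕ, Fin (k + 1)))) where
  factors := by
    intro x y φ hφ hφ'
    induction x using Lex.rec with
    | h x => ?_
    rcases x with b | s
    · exact (hφ' (isIso_of_isFSM_bot b φ hφ)).elim
    · obtain ⟨t, rfl, hst, hle⟩ := eq_of_hom_tooth s φ
      obtain ⟨k, i⟩ := s
      obtain ⟨k', j⟩ := t
      dsimp only at hst
      subst hst
      change (i : ℕ) ≤ (j : ℕ) at hle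
      have hne : (i : ℕ) ≠ j := fun h => hφ' ((isIso_iff_eq φ).mpr ((tooth_eq_iff k i j).mpr h))
      refine ⟨(j : ℕ) - i - 1 + 1, ?_⟩
      have h := isFSMIChain_of_tooth k ((j : ℕ) - i - 1) i j (by omega)
      rwa [show (homOfLE ((tooth_mk_le_iff k i j).mpr (by omega)) :
          (toLex (Sum.inr ⟨k, i⟩) : Lex ((Unit ⊕ Unit) ⊕ (Σ k : ℕ, Fin (k + 1)))) ⟶ toLex (Sum.inr ⟨k, j⟩)) = φ
          from Subsingleton.elim _ _] at h
  bounded := by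
    intro x
    induction x using Lex.rec with
    | h x => ?_
    rcases x with b | s
    · exact ⟨0, fun φ n h => (not_isFSMIChain_bot b φ n h).elim⟩
    · refine ⟨s.1, fun φ n h => ?_⟩
      obtain ⟨t, -, hst, ht⟩ := isFSMIChain_tooth φ n h s rfl
      have := t.2.isLt
      omega

/-- **The broom is NOT of FSMFF-type in the author's revised (2024) sense**: at a bottom point, the composite
"bottom → `(k,0)` → `(k,1)` → ⋯ → `(k,k)`" is a morphism with arbitrary head followed by `k` FSMI-morphisms, for
every `k`, so no bound `N` as in the revised condition (b) exists. [cite: MochizukiFrdIComments2024, (28) p.3] -/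
theorem not_isOfFSMFFType2024 : ¬ IsOfFSMFFType2024 (Lex ((Unit ⊕ Unit) ⊕ (Σ k : ℕ, Fin (k + 1)))) := by
  intro h
  obtain ⟨N, hN⟩ := h.bounded (toLex (Sum.inl (Sum.inl ())))
  -- the tooth of length `N + 1`
  have head : (toLex (Sum.inl (Sum.inl ())) : Lex ((Unit ⊕ Unit) ⊕ (Σ k : ℕ, Fin (k + 1)))) ≤
      toLex (Sum.inr ⟨N + 1, ⟨0, by omega⟩⟩) := bot_le_tooth _ _
  have tail := isFSMIChain_of_tooth (N + 1) N ⟨0, by omega⟩ ⟨N + 1, by omega⟩ (by simp)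
  have hc := IsHeadedFSMIChain.comp (P := ⊤) (homOfLE head) _ (N + 1) trivial tail
  have := hN _ _ hc
  omega

/-- **Witness: the printed (2008) class "FSMFF-type" is strictly larger than the revised (2024) class.**
[cite: MochizukiFrdIComments2024, (28) p.3] -/
theorem exists_isOfFSMFFType_not_isOfFSMFFType2024 :
    ∃ (D : Type) (_ : Category.{0} D), IsOfFSMFFType D ∧ ¬ IsOfFSMFFType2024 D :=
  ⟨Lex ((Unit ⊕ Unit) ⊕ (Σ k : ℕ, Fin (k + 1))), inferInstance, isOfFSMFFType, not_isOfFSMFFType2024⟩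

end Broom

end Literature.AlgebraicGeometry.Frobenioids
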